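import Summits.BirchSwinnertonDyer.BirchSwinnertonDyer.Theorems.GenusKolyvaginAtTwoGenusPrimitiveSupplyAtTwoTwistingPrimeLocal
import Literature.NumberTheory.Automorphic.ChebotarevArtinRepHolds
import HarnessLib

/-!
# Route `GenusKolyvaginAtTwo`, crux #2 `GenusPrimitiveSupplyAtTwo` (stmt-BirchSwinnertonDyer-22136):
# Kolyvagin primes at `2` of ANY DEPTH with abelian side conditions — unconditionally (Čebotarev)

Width seat `bsd-line-gk2-p4` g7, cell `bsd-f1-sign2`; helper (`--supports stmt-BirchSwinnertonDyer-22136`),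
fourth file of the twisting-prime series. THEOREMS ONLY: no definition, no named fact, no `sorry`; no
item is closed; BSD is not proved by any of this.

WHY. The lead's «K ↔ K_ℓ SYMMETRY» (crux workfile `Lines/genus-supply-local.md` §2) is stated at
DEPTH-`2` Kolyvagin primes `ℓ` (`Frob_ℓ` = complex conjugation on `K(E[4])`) whose auxiliary field
`K_ℓ = ℚ(√−ℓ)` is a prime Heegner field for `N` with `2` split (`ℓ ≡ 7 (mod 8)`, `ℓ ≡ −1 (mod p ∣ N)`),
possibly with further quadratic conditions (`(p/ℓ) = 1`). Their EXISTENCE (positive density by Čebotarev)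
is typed here as a kernel theorem, with no hypothesis on the image of `ρ̄_{E,2}` and no cohomology class:

* `exists_kolyvaginPrime_frobEqFrobInfty_pow` — `K` imaginary quadratic, `M ≥ 1`, `m ≥ 1`, `N ≥ 1`, a finite
  set `B₀` of primes, ANY open subgroup `A ≤ Γ_ℚ`: a prime `ℓ ∉ B₀`, `m ∣ ℓ + 1`, `IsKolyvaginPrime N W K 2 ℓ`
  (Gross), `FrobEqFrobInfty W K (2^M) ℓ` (depth `M`: `2^M ∣ ℓ + 1`, `2^M ∣ a_ℓ` by the tree's congruence
  lemmas), the Frobenius being `c₀·t` with `t ∈ Γ_{ℚ(E[2^M])} ∩ Γ_K ∩ A` (so it acts as `c₀` on whatever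
  `A` fixes).
* helpers: `isOpen_stabilizer_absoluteGaloisGroup` (stabilisers of algebraic numbers are open — admissible
  `A`), `commutator_smul_sqrt` (commutators fix square roots — for the commutator-closed side conditions of
  `exists_twistingPrime_pair` in `…TwistingPrimeKolyvagin`).

Contrast with `…TwistingPrimeKolyvagin.exists_kolyvaginPrime_not_mem_torsionLocalKer_pair` (depth ONE, but
with control of the localisation of two classes of `H¹(ℚ, E[2])`): at depth `≥ 2` the class control is
not available by that argument (commutators leave `Γ_{ℚ(E[4])}`; Lawson–Wuthrich's class).

References: [GrossLMS1991] §3 (3.1)–(3.3); [McCallumLMS1991] §3 Cor. 3.2, §4; [SerreAbelianLadic1968] I §2.2.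
-/

set_option linter.dupNamespace false -- tree convention: `Summit.BirchSwinnertonDyer.BirchSwinnertonDyer.Theorems` (summit = sub-problem)
set_option autoImplicit false

noncomputable section

open scoped Classical Pointwise

namespace Summit.BirchSwinnertonDyer.BirchSwinnertonDyer.Theorems.GenusKolyTwistingPrime

open WeierstrassCurve NumberField IsDedekindDomain Field
open Literature.NumberTheory.GaloisRepresentations Literature.NumberTheory.EllipticCurves
open Literature.NumberTheory

/-! ## §10 Kolyvagin primes of any depth with abelian side conditions (no cohomology class) -/

section Depth

variable (W : WeierstrassCurve ℚ) [W.IsElliptic] {K : Type} [Field K] [NumberField K]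

omit [W.IsElliptic] in
/-- The stabiliser in `Γ_ℚ` of an element of `ℚ̄` is open (it contains `Gal(ℚ̄/ℚ(α))`, open for the
Krull topology since `ℚ(α)/ℚ` is finite). [folklore] -/
theorem isOpen_stabilizer_absoluteGaloisGroup (α : AlgebraicClosure ℚ) :
    IsOpen ((MulAction.stabilizer (absoluteGaloisGroup ℚ) α : Subgroup (absoluteGaloisGroup ℚ)) :
      Set (absoluteGaloisGroup ℚ)) := by
  haveI : FiniteDimensional ℚ (IntermediateField.adjoin ℚ {α}) :=
    IntermediateField.adjoin.finiteDimensional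
      ((AlgebraicClosure.isAlgebraic ℚ).isAlgebraic α).isIntegral
  refine Subgroup.isOpen_mono (H₁ := (IntermediateField.adjoin ℚ {α}).fixingSubgroup) ?_
    (IntermediateField.fixingSubgroup_isOpen _)
  intro σ hσ
  rw [IntermediateField.mem_fixingSubgroup_iff] at hσ
  exact hσ α (IntermediateField.mem_adjoin_simple_self ℚ α)

omit [W.IsElliptic] in
/-- Commutators of `Γ_ℚ` fix every square root of a rational number (`σ α = ± α` for all `σ`):
the stabiliser of `√q` is an admissible side condition `A` below, e.g. to force `(p/ℓ) = 1` or
inertness in `ℚ(√d)`. [folklore] -/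
theorem commutator_smul_sqrt {α : AlgebraicClosure ℚ} {q : ℚ} (hα : α ^ 2 = algebraMap ℚ _ q)
    (γ δ : absoluteGaloisGroup ℚ) : (γ * δ * γ⁻¹ * δ⁻¹) • α = α := by
  have hsign : ∀ σ : absoluteGaloisGroup ℚ, σ • α = α ∨ σ • α = -α := fun σ ↦ by
    have h : (σ • α) ^ 2 = α ^ 2 := by rw [← smul_pow', hα, smul_algebraMap]
    rcases eq_or_eq_neg_of_sq_eq_sq _ _ h with h | h
    · exact Or.inl h
    · exact Or.inr h
  have hcomm : ∀ σ τ : absoluteGaloisGroup ℚ, (σ * τ) • α = (τ * σ) • α := fun σ τ ↦ by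
    rw [mul_smul, mul_smul]
    rcases hsign σ with hs | hs <;> rcases hsign τ with ht | ht <;>
      simp only [hs, ht, smul_neg, neg_neg]
  have h := hcomm γ⁻¹ δ⁻¹
  have e : γ * δ * γ⁻¹ * δ⁻¹ = (γ * δ) * (δ * γ)⁻¹ := by group
  rw [e, mul_smul, mul_inv_rev, h, ← mul_smul]
  have e' : γ * δ * (δ⁻¹ * γ⁻¹) = 1 := by group
  rw [e', one_smul]

/-- **KOLYVAGIN PRIMES AT `2` OF ANY DEPTH, WITH ABELIAN SIDE CONDITIONS** (Čebotarev; no hypothesis on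
the image of `ρ̄`, no cohomology class). `W/ℚ` elliptic, `K` imaginary quadratic, `M ≥ 1`, `m ≥ 1`,
`N ≥ 1`, a finite set `B₀` of rational primes, and ANY OPEN subgroup `A ≤ Γ_ℚ` (e.g. the fixer of a
finite extension: `ζ`'s, square roots, `E[4]`-coordinates, …). Then there is a prime `ℓ ∉ B₀` with
`m ∣ ℓ + 1` which is a Kolyvagin prime for `(E, K, 2)` at level `N` in Gross's sense AND of depth `M`:
`FrobEqFrobInfty W K (2^M) ℓ` (so `2^M ∣ ℓ + 1`, `2^M ∣ a_ℓ` by `pow_dvd_add_one_of_frobEqFrobInfty` /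
`pow_dvd_frobeniusTraceAt_of_frobEqFrobInfty`), its Frobenius being `c₀·t` with
`t ∈ Γ_{ℚ(E[2^M])} ∩ Γ_K ∩ A` — it acts as the complex conjugation `c₀` on everything `A` fixes. With
`8N ∣ m` the auxiliary field `ℚ(√−ℓ)` is then a prime Heegner field for `N` with `2` split (the lead's
«K ↔ K_ℓ symmetry» at depth-`2` primes, `Lines/genus-supply-local.md` §2).
[cite: GrossLMS1991, §3 (3.1)–(3.3)] [cite: McCallumLMS1991, §3 Cor. 3.2, §4 (Kolyvagin primes of level M)] -/
theorem exists_kolyvaginPrime_frobEqFrobInfty_pow (hK : IsImaginaryQuadratic K) {M : ℕ} (hM : 1 ≤ M)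
    {m : ℕ} (hm : m ≠ 0) (N : ℕ) [NeZero N] (B₀ : Finset ℕ)
    (A : Subgroup (absoluteGaloisGroup ℚ)) (hAopen : IsOpen (A : Set (absoluteGaloisGroup ℚ))) :
    ∃ ℓ : ℕ, ℓ ∉ B₀ ∧ m ∣ ℓ + 1 ∧ IsKolyvaginPrime N W K 2 ℓ ∧ FrobEqFrobInfty W K (2 ^ M) ℓ ∧
      ∃ (v : HeightOneSpectrum (𝓞 ℚ)) (𝔓 : Ideal (absIntegers (𝓞 ℚ) ℚ)) (c₀ t : absoluteGaloisGroup ℚ),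
        (ℓ : 𝓞 ℚ) ∈ v.asIdeal ∧ 𝔓 ∈ v.primesAbove ∧ IsArithFrobAt (𝓞 ℚ) (c₀ * t) 𝔓 ∧
        IsComplexConjugation (Rat.castHom ℝ) c₀ ∧ t ∈ torsionFixing W ((2 ^ M : ℕ) : ℤ) ∧ t ∈ A := by
  classical
  haveI : NeZero m := ⟨hm⟩
  obtain ⟨c₀, hc₀⟩ := exists_isComplexConjugation (Rat.castHom ℝ)
  haveI : Algebra.IsQuadraticExtension ℚ K := ⟨hK.1⟩
  haveI : IsTotallyComplex K := hK.2
  have hn0 : ((2 ^ M : ℕ) : ℤ) ≠ 0 := by exact_mod_cast pow_ne_zero M two_ne_zero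
  -- a primitive `m`-th root of unity
  have hq0 : ((m : ℕ) : AlgebraicClosure ℚ) ≠ 0 := by exact_mod_cast hm
  haveI : NeZero ((m : ℕ) : AlgebraicClosure ℚ) := ⟨hq0⟩
  obtain ⟨ζ, hζ⟩ := IsAlgClosed.exists_root (Polynomial.cyclotomic m (AlgebraicClosure ℚ))
    (Polynomial.degree_cyclotomic_pos m _ (Nat.pos_of_ne_zero hm)).ne'
  have hprim : IsPrimitiveRoot ζ m := Polynomial.isRoot_cyclotomic_iff.mp hζ
  -- `Γ_K ≤ Γ_ℚ`
  set H := (absGaloisRestrict ℚ K).range with hH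
  have hHi : H.index = 2 := (index_range_absGaloisRestrict_eq_finrank ℚ K).trans hK.1
  haveI hHn : H.Normal := Subgroup.normal_of_index_eq_two hHi
  have hHopen : IsOpen (H : Set (absoluteGaloisGroup ℚ)) := by
    have h := (isOpenMap_absGaloisRestrict (K := K)) _ isOpen_univ
    rw [Set.image_univ] at h
    convert h using 1
    ext σ
    simp only [hH, SetLike.mem_coe, MonoidHom.mem_range, Set.mem_range]
    rfl
  -- the finite exceptional set
  set B : Finset ℕ := B₀ ∪ m.primeFactors ∪ N.primeFactors ∪
    (NumberField.discr K).natAbs.primeFactors ∪ {2} with hB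
  set S : Set (HeightOneSpectrum (𝓞 ℚ)) :=
    {v | ∃ q ∈ B, q.Prime ∧ (q : 𝓞 ℚ) ∈ v.asIdeal} ∪ {v | ¬ Algebra.IsUnramifiedIn (𝓞 K) v.asIdeal}
    with hS
  have hSfin : S.Finite := by
    refine Set.Finite.union ?_ (finite_setOf_not_isUnramifiedIn ℚ K)
    have : {v : HeightOneSpectrum (𝓞 ℚ) | ∃ q ∈ B, q.Prime ∧ (q : 𝓞 ℚ) ∈ v.asIdeal} ⊆
        ⋃ q ∈ (B.filter Nat.Prime), {v | (q : 𝓞 ℚ) ∈ v.asIdeal} := by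
      intro v ⟨q, hqB, hq, hqv⟩
      simp only [Set.mem_iUnion, Finset.mem_filter]
      exact ⟨q, ⟨hqB, hq⟩, hqv⟩
    refine Set.Finite.subset (Set.Finite.biUnion (Finset.finite_toSet _) fun q hq ↦ ?_) this
    rw [Finset.coe_filter, Set.mem_setOf_eq] at hq
    have hsub : {v : HeightOneSpectrum (𝓞 ℚ) | (q : 𝓞 ℚ) ∈ v.asIdeal}.Subsingleton :=
      fun v hv v' hv' ↦ HeightOneSpectrum.eq_of_natCast_mem_rat hq.2 hv hv'
    exact hsub.finite
  -- Čebotarev in the open set `c₀ · (Γ_{ℚ(E[2^M])} ∩ Stab ζ ∩ A ∩ Γ_K)`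
  set T := torsionFixing W ((2 ^ M : ℕ) : ℤ) with hT
  have hTopen : IsOpen (T : Set (absoluteGaloisGroup ℚ)) := isOpen_torsionFixing W hn0
  set St : Subgroup (absoluteGaloisGroup ℚ) := MulAction.stabilizer (absoluteGaloisGroup ℚ) ζ with hSt
  have hStopen : IsOpen (St : Set (absoluteGaloisGroup ℚ)) := isOpen_stabilizer_absoluteGaloisGroup ζ
  set U : Set (absoluteGaloisGroup ℚ) :=
    (((T : Set _) ∩ (St : Set _)) ∩ (A : Set _)) ∩ (H : Set _) with hU
  have hUopen : IsOpen U := ((hTopen.inter hStopen).inter hAopen).inter hHopen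
  set O : Set (absoluteGaloisGroup ℚ) := (fun γ ↦ c₀ * γ) '' U with hO
  have hOopen : IsOpen O := (Homeomorph.mulLeft c₀).isOpenMap _ hUopen
  have hOne : O.Nonempty := ⟨c₀ * 1, 1, ⟨⟨⟨T.one_mem, St.one_mem⟩, A.one_mem⟩, H.one_mem⟩, rfl⟩
  obtain ⟨γ, hγO, v, hvS, 𝔓₀, h𝔓₀, hγ⟩ :=
    (absoluteGaloisGroup.frobenius_dense Automorphic.chebotarev_artinRep_holds ℚ S hSfin
      ).inter_open_nonempty O hOopen hOne
  obtain ⟨t, ⟨⟨⟨htT, htSt⟩, htA⟩, htH⟩, rfl⟩ := hγO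
  have htζ : t • ζ = ζ := htSt
  -- the rational prime `ℓ` under `v`
  obtain ⟨ℓ, hℓ, hℓv⟩ := exists_prime_natCast_mem v
  have hℓB : ℓ ∉ B := fun h ↦ hvS (Or.inl ⟨ℓ, h, hℓ, hℓv⟩)
  simp only [hB, Finset.mem_union, Finset.mem_singleton, Nat.mem_primeFactors, not_or] at hℓB
  obtain ⟨⟨⟨⟨hℓB₀, hℓm'⟩, hℓN⟩, hℓD⟩, hℓ2⟩ := hℓB
  have hℓm : ¬ ℓ ∣ m := fun h ↦ hℓm' ⟨hℓ, h, hm⟩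
  have hℓN' : ¬ ℓ ∣ N := fun h ↦ hℓN ⟨hℓ, h, NeZero.ne N⟩
  have hℓD' : ¬ ((ℓ : ℤ) ∣ NumberField.discr K) := fun h ↦
    hℓD ⟨hℓ, Int.natAbs_dvd_natAbs.mpr h |>.trans (by simp), by simp [NumberField.discr_ne_zero]⟩
  have hunr : Algebra.IsUnramifiedIn (𝓞 K) v.asIdeal := by
    by_contra h; exact hvS (Or.inr h)
  -- `m ∣ ℓ + 1`
  have hmv : (m : 𝓞 ℚ) ∉ v.asIdeal := natCast_not_mem_of_not_dvd hℓ hℓv hℓm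
  have h1 : (c₀ * t) • ζ = ζ⁻¹ := by
    rw [mul_smul, htζ, RatClosure.smul_eq_inv_of_pow_eq_one hc₀ hm hprim.pow_eq_one]
  have h2 : (c₀ * t) • ζ = ζ ^ v.residueCard :=
    smul_eq_pow_residueCard_of_isArithFrobAt_of_pow_eq_one hmv h𝔓₀ hγ hprim.pow_eq_one
  rw [residueCard_eq_of_natCast_mem_rat hℓ hℓv, h1] at h2
  have hζ0 : ζ ≠ 0 := hprim.ne_zero hm
  have hζ1 : ζ ^ (ℓ + 1) = 1 := by rw [pow_succ, ← h2, inv_mul_cancel₀ hζ0]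
  have hmdvd : m ∣ ℓ + 1 := (hprim.pow_eq_one_iff_dvd (ℓ + 1)).mp hζ1
  -- `ℓ` is inert in `K`
  have hI := inertia_le_range_absGaloisRestrict_of_isUnramifiedIn (K := K) hunr h𝔓₀
  have hΦH : c₀ * t ∉ H := by
    intro h
    apply hc₀.not_mem_range_absGaloisRestrict (L := K) IsTotallyComplex.isComplex
    change c₀ ∈ ((absGaloisRestrict ℚ K).range : Set (absoluteGaloisGroup ℚ))
    have h' : c₀ = c₀ * t * t⁻¹ := by group
    rw [SetLike.mem_coe, h']
    exact Subgroup.mul_mem _ h (Subgroup.inv_mem _ htH)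
  obtain ⟨w, 𝔔, τ', hwv, hwuniq, -, -, -, -, -⟩ :=
    exists_place_inert_of_not_mem_range (F := ℚ) (M := K) (hK.1 ▸ Nat.prime_two) hHn
      (index_range_absGaloisRestrict_eq_finrank ℚ K) hunr h𝔓₀ hI hγ hΦH
  have hwuniq' : ∀ w' : HeightOneSpectrum (𝓞 K), (ℓ : 𝓞 K) ∈ w'.asIdeal → w' = w := by
    intro w' hw'
    apply hwuniq
    apply HeightOneSpectrum.eq_of_natCast_mem_rat hℓ _ hℓv
    rw [HeightOneSpectrum.under_asIdeal, Ideal.under_def, Ideal.mem_comap, map_natCast]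
    exact hw'
  have hspan : Ideal.span {(ℓ : 𝓞 K)} = w.asIdeal := by
    apply span_natCast_eq_of_unique hℓ w hwuniq'
    haveI : w.asIdeal.LiesOver v.asIdeal := ⟨by rw [← hwv]; rfl⟩
    have hmap : v.asIdeal.map (algebraMap (𝓞 ℚ) (𝓞 K)) = Ideal.span {(ℓ : 𝓞 K)} := by
      rw [← span_natCast_rat_eq hℓ hℓv, Ideal.map_span, Set.image_singleton, map_natCast]
    have hne : v.asIdeal.map (algebraMap (𝓞 ℚ) (𝓞 K)) ≠ ⊥ := by
      rw [hmap, Ne, Ideal.span_singleton_eq_bot]; exact_mod_cast hℓ.ne_zero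
    rw [← hmap, ← Ideal.IsDedekindDomain.ramificationIdx_eq_normalizedFactors_count v.asIdeal
      w.asIdeal hne]
    exact Ideal.ramificationIdx_eq_one_iff.mpr (hunr w.asIdeal w.isPrime inferInstance)
  -- `Frob(ℓ) = Frob(∞)` on `E[2^M]` (hence on `E[2]`) and on `K`
  obtain ⟨g, hg⟩ := htH
  have hg' : absGaloisRestrict ℚ K g = t := hg
  have hK' : ∀ (e : K →ₐ[ℚ] AlgebraicClosure ℚ) (z : K), (c₀ * t) • e z = c₀ • e z := fun e z ↦ by
    rw [mul_smul, ← hg', absGaloisRestrict_smul_apply_eq g e z]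
  have hFrobM : FrobEqFrobInfty W K (2 ^ M) ℓ :=
    ⟨v, 𝔓₀, c₀ * t, c₀, hℓv, h𝔓₀, hγ, hc₀, fun P ↦ by
      rw [mul_smul]; exact congrArg (c₀ • ·) (smul_eq_of_mem_torsionFixing W _ htT P), hK'⟩
  have hFrob1 : FrobEqFrobInfty W K 2 ℓ :=
    FrobEqFrobInfty.of_dvd (W := W) (K := K) (dvd_pow_self 2 (by omega)) hFrobM
  exact ⟨ℓ, hℓB₀, hmdvd, ⟨hℓ, hℓN', hℓD', hℓ2, hspan ▸ w.isPrime, hFrob1⟩, hFrobM,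
    v, 𝔓₀, c₀, t, hℓv, h𝔓₀, hγ, hc₀, htT, htA⟩

end Depth

end Summit.BirchSwinnertonDyer.BirchSwinnertonDyer.Theorems.GenusKolyTwistingPrime

end
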